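import Summits.CriticalPhenomena.PercolationContinuityZ3.Theorems.PercNearOneGluingNoHeavyLowerTailSunflowerGradedTBernState
import HarnessLib

/-!
# `NoHeavyLowerTail` (crux stmt-CriticalPhenomena-4575), abstract sunflower cubic: GRADED T-BERN — the certificate `DomG` for
# {hub, x-type pack} and {hub, x-type pack, last γ-heavy petal} families

Support file (seat `prim-ineq-prove-1` gen 69; `--supports stmt-CriticalPhenomena-4575`).  No `sorry`, no named facts, no
definitions.  Memo: run/shared/lean/prim/prim-ineq-prove-1/FINDING-GRADED-prove1-g69.md §3.

The irreducible families of the T-BERN reduction (`…SunflowerTBernIrreducible`) that are not aligned consist of ONE hub `P`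
(the unique non-γ-heavy petal), γ-heavy x-TYPE petals (`α_j ≤ γ_j ≤ x_j` normalised, i.e. `a₀A_j ≤ A₀g_j` and `b·g_j ≤ a₀u_j`:
sub-dwarfs, floors, non-leveraged tight petals) and at most ONE further γ-heavy petal `r` (the h-petal or the leveraged T2).
The hub singleton plus the x-type petals are absorbed by `zone_extend_flex` (`…SunflowerTBernHubPackH`) into a state
`(A′, ∏γ)` with `A′ ≤ α(∏x)`; the last step of `…SunflowerGradedTBernEndgame` (via `domG_of_state0` / `domG_of_state_r`)
then gives **`domG_hub_pack`** and **`domG_hub_pack_r`**.  No (HC)-type condition is needed (the caps are at `V = 1`).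
-/

noncomputable section

namespace Summit.CriticalPhenomena.PercolationContinuityZ3.Theorems.SunflowerPartition

namespace SafeCalc

namespace LinkedCurrency

open Finset Polynomial

variable {ι : Type*}

/-! ## {hub, x-type pack (, last γ-heavy petal)} families -/

/-- **`DomG` for {hub, x-type pack} families.**  `P ∈ t` arbitrary; every other petal γ-heavy (`a₀A_j ≤ A₀g_j`) and x-type
(`b·g_j ≤ a₀·u_j`) — sub-dwarfs, floors, non-leveraged tight petals.  Parameters `0 < b ≤ β`, `0 ≤ s ≤ 1`, `x ∈ [a₀,1]`.
[this work] -/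
theorem domG_hub_pack [DecidableEq ι] {s b β x : ℝ} (hb : 0 < b) (hbβ : b ≤ β) (hs0 : 0 ≤ s) (hs1 : s ≤ 1)
    (hax : (1 - s) * b + s * β ≤ x) (hx1 : x ≤ 1) {t : Finset ι} {u vv m : ι → ℝ}
    (hadm : AdmissibleG s b β x t u vv m) {P : ι} (hP : P ∈ t)
    (hW : ∀ j ∈ t, j ≠ P → ((1 - s) * b + s * β) * (s + (1 - s) * u j) ≤ (s + (1 - s) * b) * ((1 - s) * m j + s * vv j) ∧
      b * ((1 - s) * m j + s * vv j) ≤ ((1 - s) * b + s * β) * u j) :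
    DomG s b β x t u vv m := by
  obtain ⟨hub, hu1, hvβ, -, hmb, -, -, hpu, -, -⟩ := id hadm
  have hs' : 0 ≤ 1 - s := sub_nonneg.2 hs1
  set A₀ := s + (1 - s) * b with hA₀d
  set a₀ := (1 - s) * b + s * β with ha₀d
  have ht : t.Nonempty := ⟨P, hP⟩
  have hβ : 0 < β := hb.trans_le hbβ
  have hb1 : b ≤ 1 := (hub P hP).trans (hu1 P hP)
  have hA₀ : 0 < A₀ := by
    have : 0 ≤ s * (1 - b) := mul_nonneg hs0 (sub_nonneg.2 hb1)
    have e : A₀ = b + s * (1 - b) := by rw [hA₀d]; ring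
    rw [e]; linarith
  have ha₀ : 0 < a₀ := by
    have : 0 ≤ s * (β - b) := mul_nonneg hs0 (sub_nonneg.2 hbβ)
    have e : a₀ = b + s * (β - b) := by rw [ha₀d]; ring
    rw [e]; linarith
  set κ := (1 - s) * b / A₀ with hκ
  have hκ0 : 0 ≤ κ := div_nonneg (mul_nonneg hs' hb.le) hA₀.le
  have hκ1 : κ ≤ 1 := by rw [hκ, div_le_one hA₀, hA₀d]; linarith
  set xf : ι → ℝ := fun j => u j / b with hxd
  set αf : ι → ℝ := fun j => (s + (1 - s) * u j) / A₀ with hαd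
  set γf : ι → ℝ := fun j => ((1 - s) * m j + s * vv j) / a₀ with hγd
  have hx : ∀ j ∈ t, 1 ≤ xf j := fun j hj => by rw [hxd]; exact (one_le_div hb).2 (hub j hj)
  have hα : ∀ j, αf j = 1 + κ * (xf j - 1) := by
    intro j; rw [hαd, hκ, hxd]; field_simp; rw [hA₀d]; ring
  have hγ1 : ∀ j ∈ t, 1 ≤ γf j := fun j hj => by
    rw [hγd]; refine (one_le_div ha₀).2 ?_
    have := mul_le_mul_of_nonneg_left (hmb j hj) hs'
    have := mul_le_mul_of_nonneg_left (hvβ j hj) hs0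
    rw [ha₀d]; linarith
  -- the pack `W = t ∖ {P}` is γ-heavy and x-type
  set W := t.erase P with hWd
  have hWγx : ∀ j ∈ W, γf j ≤ xf j := fun j hj => by
    have hj' := mem_of_mem_erase hj
    rw [hγd, hxd, div_le_div_iff₀ ha₀ hb]
    have := (hW j hj' (mem_erase.1 hj).1).2; rw [ha₀d]; linarith
  have hWg : ∀ j ∈ W, 1 + κ * (xf j - 1) ≤ γf j := fun j hj => by
    have hj' := mem_of_mem_erase hj
    rw [← hα, hαd, hγd, div_le_div_iff₀ hA₀ ha₀]
    have := (hW j hj' (mem_erase.1 hj).1).1; linarith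
  -- the hub singleton and the flexible absorption
  have hbase : CoefDom (prodPoly {P} (fun j => 1 + κ * (xf j - 1)) γf)
      ((C 1 * X + C 1) ^ (({P} : Finset ι).card - 1) * (C (1 + κ * (xf P - 1)) * X + C (γf P))) :=
    coefDom_prodPoly_singleton le_rfl le_rfl
  have hdis : Disjoint ({P} : Finset ι) W := by rw [disjoint_singleton_left]; exact notMem_erase P t
  obtain ⟨A', hdom, hA'le, _, -⟩ := zone_extend_flex hκ0 hκ1 xf γf {P} (singleton_nonempty P) (hx P hP) (hγ1 P hP)
    le_rfl (zero_le_one.trans (by have := mul_nonneg hκ0 (sub_nonneg.2 (hx P hP)); linarith)) hbase W hdis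
    (fun j hj => hx j (mem_of_mem_erase hj)) hWγx hWg
  have htW : {P} ∪ W = t := by rw [hWd, ← insert_eq, insert_erase hP]
  rw [htW] at hdom
  -- `A' ≤ α(x_P ∏_W x) ≤ 1/A₀`
  have hX : ∏ j ∈ t, xf j ≤ 1 / b := by
    rw [hxd, prod_div_distrib, prod_const, div_le_div_iff₀ (pow_pos hb _) hb, one_mul]
    calc (∏ j ∈ t, u j) * b ≤ b ^ (t.card - 1) * b := mul_le_mul_of_nonneg_right hpu hb.le
      _ = b ^ t.card := by rw [← pow_succ]; congr 1; have := ht.card_pos; omega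
  have hXt : xf P * ∏ j ∈ W, xf j = ∏ j ∈ t, xf j := by rw [hWd, mul_prod_erase t xf hP]
  have hA'1 : A' ≤ 1 / A₀ := by
    rw [hXt] at hA'le
    refine hA'le.trans ?_
    have h2 : 1 + κ * (∏ j ∈ t, xf j - 1) ≤ 1 + κ * (1 / b - 1) := by
      have := mul_le_mul_of_nonneg_left (sub_le_sub_right hX 1) hκ0; linarith
    have h3 : 1 + κ * (1 / b - 1) = 1 / A₀ := by
      rw [hκ, eq_div_iff hA₀.ne']
      have e1 : (1 + (1 - s) * b / A₀ * (1 / b - 1)) * A₀ = A₀ + (1 - s) * b * (1 / b - 1) := by field_simp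
      have e2 : (1 - s) * b * (1 / b - 1) = (1 - s) * (1 - b) := by field_simp
      rw [e1, e2, hA₀d]; ring
    linarith
  have hGt : γf P * ∏ j ∈ W, γf j = ∏ j ∈ t, γf j := by rw [hWd, mul_prod_erase t γf hP]
  rw [hGt, prodPoly_congr (fun j _ => (hα j).symm) (fun _ _ => rfl)] at hdom
  exact domG_of_state0 hb hbβ hs0 hs1 hax hx1 ht hadm hA'1 hdom

/-- **`DomG` for {hub, x-type pack, last γ-heavy petal} families.**  `P ≠ r` in `t`; every petal other than `P, r` is γ-heavy
and x-type; `r` is γ-heavy (the h-petal or a leveraged tight petal).  Parameters `0 < b ≤ β ≤ 1`, `0 ≤ s ≤ 1`, `a₀ ≤ x`.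
[this work] -/
theorem domG_hub_pack_r [DecidableEq ι] {s b β x : ℝ} (hb : 0 < b) (hbβ : b ≤ β) (hβ1 : β ≤ 1) (hs0 : 0 ≤ s)
    (hs1 : s ≤ 1) (hax : (1 - s) * b + s * β ≤ x) {t : Finset ι} {u vv m : ι → ℝ}
    (hadm : AdmissibleG s b β x t u vv m) {P r : ι} (hP : P ∈ t) (hr : r ∈ t) (hrP : r ≠ P)
    (hW : ∀ j ∈ t, j ≠ P → j ≠ r →
      ((1 - s) * b + s * β) * (s + (1 - s) * u j) ≤ (s + (1 - s) * b) * ((1 - s) * m j + s * vv j) ∧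
      b * ((1 - s) * m j + s * vv j) ≤ ((1 - s) * b + s * β) * u j)
    (hrγ : ((1 - s) * b + s * β) * (s + (1 - s) * u r) ≤ (s + (1 - s) * b) * ((1 - s) * m r + s * vv r)) :
    DomG s b β x t u vv m := by
  obtain ⟨hub, hu1, hvβ, -, hmb, -, -, hpu, -, -⟩ := id hadm
  have hs' : 0 ≤ 1 - s := sub_nonneg.2 hs1
  set A₀ := s + (1 - s) * b with hA₀d
  set a₀ := (1 - s) * b + s * β with ha₀d
  have ht : t.Nonempty := ⟨P, hP⟩
  have hβ : 0 < β := hb.trans_le hbβ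
  have hb1 : b ≤ 1 := (hub P hP).trans (hu1 P hP)
  have hA₀ : 0 < A₀ := by
    have : 0 ≤ s * (1 - b) := mul_nonneg hs0 (sub_nonneg.2 hb1)
    have e : A₀ = b + s * (1 - b) := by rw [hA₀d]; ring
    rw [e]; linarith
  have ha₀ : 0 < a₀ := by
    have : 0 ≤ s * (β - b) := mul_nonneg hs0 (sub_nonneg.2 hbβ)
    have e : a₀ = b + s * (β - b) := by rw [ha₀d]; ring
    rw [e]; linarith
  set κ := (1 - s) * b / A₀ with hκ
  have hκ0 : 0 ≤ κ := div_nonneg (mul_nonneg hs' hb.le) hA₀.le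
  have hκ1 : κ ≤ 1 := by rw [hκ, div_le_one hA₀, hA₀d]; linarith
  set xf : ι → ℝ := fun j => u j / b with hxd
  set αf : ι → ℝ := fun j => (s + (1 - s) * u j) / A₀ with hαd
  set γf : ι → ℝ := fun j => ((1 - s) * m j + s * vv j) / a₀ with hγd
  have hx : ∀ j ∈ t, 1 ≤ xf j := fun j hj => by rw [hxd]; exact (one_le_div hb).2 (hub j hj)
  have hα : ∀ j, αf j = 1 + κ * (xf j - 1) := by
    intro j; rw [hαd, hκ, hxd]; field_simp; rw [hA₀d]; ring
  have hγ1 : ∀ j ∈ t, 1 ≤ γf j := fun j hj => by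
    rw [hγd]; refine (one_le_div ha₀).2 ?_
    have := mul_le_mul_of_nonneg_left (hmb j hj) hs'
    have := mul_le_mul_of_nonneg_left (hvβ j hj) hs0
    rw [ha₀d]; linarith
  -- the pack `W = t ∖ {P, r}`
  set t' := t.erase r with ht'd
  have hPt' : P ∈ t' := mem_erase.2 ⟨hrP.symm, hP⟩
  set W := t'.erase P with hWd
  have hWt : ∀ j ∈ W, j ∈ t ∧ j ≠ P ∧ j ≠ r := fun j hj =>
    ⟨mem_of_mem_erase (mem_of_mem_erase hj), (mem_erase.1 hj).1, (mem_erase.1 (mem_of_mem_erase hj)).1⟩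
  have hWγx : ∀ j ∈ W, γf j ≤ xf j := fun j hj => by
    obtain ⟨hj', hjP, hjr⟩ := hWt j hj
    rw [hγd, hxd, div_le_div_iff₀ ha₀ hb]
    have := (hW j hj' hjP hjr).2; rw [ha₀d]; linarith
  have hWg : ∀ j ∈ W, 1 + κ * (xf j - 1) ≤ γf j := fun j hj => by
    obtain ⟨hj', hjP, hjr⟩ := hWt j hj
    rw [← hα, hαd, hγd, div_le_div_iff₀ hA₀ ha₀]
    have := (hW j hj' hjP hjr).1; linarith
  have hbase : CoefDom (prodPoly {P} (fun j => 1 + κ * (xf j - 1)) γf)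
      ((C 1 * X + C 1) ^ (({P} : Finset ι).card - 1) * (C (1 + κ * (xf P - 1)) * X + C (γf P))) :=
    coefDom_prodPoly_singleton le_rfl le_rfl
  have hdis : Disjoint ({P} : Finset ι) W := by rw [disjoint_singleton_left]; exact notMem_erase P t'
  obtain ⟨A', hdom, hA'le, hA'0, -⟩ := zone_extend_flex hκ0 hκ1 xf γf {P} (singleton_nonempty P) (hx P hP) (hγ1 P hP)
    le_rfl (zero_le_one.trans (by have := mul_nonneg hκ0 (sub_nonneg.2 (hx P hP)); linarith)) hbase W hdis
    (fun j hj => hx j (hWt j hj).1) hWγx hWg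
  have htW : {P} ∪ W = t' := by rw [hWd, ← insert_eq, insert_erase hPt']
  rw [htW] at hdom
  -- `A'·α_r ≤ α(∏_{t'} x)·α(x_r) ≤ α(∏_t x) ≤ 1/A₀`
  have hX : ∏ j ∈ t, xf j ≤ 1 / b := by
    rw [hxd, prod_div_distrib, prod_const, div_le_div_iff₀ (pow_pos hb _) hb, one_mul]
    calc (∏ j ∈ t, u j) * b ≤ b ^ (t.card - 1) * b := mul_le_mul_of_nonneg_right hpu hb.le
      _ = b ^ t.card := by rw [← pow_succ]; congr 1; have := ht.card_pos; omega
  have hXt' : xf P * ∏ j ∈ W, xf j = ∏ j ∈ t', xf j := by rw [hWd, mul_prod_erase t' xf hPt']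
  have hXt : (∏ j ∈ t', xf j) * xf r = ∏ j ∈ t, xf j := by rw [ht'd, mul_comm, mul_prod_erase t xf hr]
  have hX'1 : 1 ≤ ∏ j ∈ t', xf j := Pendant.one_le_prod_of_one_le _ fun j hj => hx j (mem_of_mem_erase hj)
  have hαr0 : 0 ≤ αf r := by rw [hα]; have := mul_nonneg hκ0 (sub_nonneg.2 (hx r hr)); linarith
  have hA'1 : A' * αf r ≤ 1 / A₀ := by
    rw [hXt'] at hA'le
    have h1 : A' * αf r ≤ (1 + κ * (∏ j ∈ t', xf j - 1)) * (1 + κ * (xf r - 1)) := by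
      rw [hα r]; exact mul_le_mul_of_nonneg_right hA'le (by rw [← hα]; exact hαr0)
    have h2 := alpha_mul_le hκ0 hκ1 hX'1 (hx r hr)
    rw [hXt] at h2
    have h3 : 1 + κ * (∏ j ∈ t, xf j - 1) ≤ 1 + κ * (1 / b - 1) := by
      have := mul_le_mul_of_nonneg_left (sub_le_sub_right hX 1) hκ0; linarith
    have h4 : 1 + κ * (1 / b - 1) = 1 / A₀ := by
      rw [hκ, eq_div_iff hA₀.ne']
      have e1 : (1 + (1 - s) * b / A₀ * (1 / b - 1)) * A₀ = A₀ + (1 - s) * b * (1 / b - 1) := by field_simp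
      have e2 : (1 - s) * b * (1 / b - 1) = (1 - s) * (1 - b) := by field_simp
      rw [e1, e2, hA₀d]; ring
    linarith
  have hGt : γf P * ∏ j ∈ W, γf j = ∏ j ∈ t', γf j := by rw [hWd, mul_prod_erase t' γf hPt']
  rw [hGt, prodPoly_congr (fun j _ => (hα j).symm) (fun _ _ => rfl)] at hdom
  exact domG_of_state_r hb hbβ hβ1 hs0 hs1 hax hadm hr ⟨P, hPt'⟩ hrγ hA'0 hA'1 hdom

end LinkedCurrency

end SafeCalc

end Summit.CriticalPhenomena.PercolationContinuityZ3.Theorems.SunflowerPartition
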